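import Literature.Geometry.DiscreteGeometry.DelsarteLinearProgrammingBound
import Literature.Geometry.DiscreteGeometry.ThreePointBound
import Mathlib.Analysis.InnerProductSpace.PiL2
import Mathlib.Analysis.InnerProductSpace.Projection.FiniteDimensional
import HarnessLib

/-!
# Bachoc–Vallentin three-point positivity on `S^{n-1}` for every dimension `n ≥ 4`

The kernels of the semidefinite (three-point) bound of Bachoc–Vallentin (J. AMS 21 (2008),
§3) in **all** dimensions `n ≥ 4`. For a fixed unit vector `e ∈ ℝⁿ` ("pole") write a unit vector
`x` as `x = u e + √(1-u²) x'` with `u = e·x` and `x'` a unit vector of the hyperplane `e^⊥ ≅ ℝ^{n-1}`;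
then for unit `x, y` with `u = e·x`, `v = e·y`, `t = x·y` one has `x'·y' = (t - uv)/√((1-u²)(1-v²))`,
and Theorem 3.2 of Bachoc–Vallentin shows that the zonal matrices of the stabiliser of `e` have
entries `u^i v^j Q_k^{n-1}(u,v,t)` (Remark 3.4) with
`Q_k^{n-1}(u,v,t) = ((1-u²)(1-v²))^{k/2} P_k^{n-1}((t-uv)/√((1-u²)(1-v²)))`, `P_k^{n-1}` the
Gegenbauer polynomial of `S^{n-2}` (parameter `(n-3)/2`). Consequently (Corollary 3.5, (pos Y) and
(pos S)): for every finite `C ⊂ S^{n-1}`, `Σ_{(c,c') ∈ C²} Y_k^n(e·c, e·c', c·c') ⪰ 0` and the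
triple sums of the symmetrisations `S_k^n` are `⪰ 0`.

What is here (namespace `Literature.Geometry.DiscreteGeometry.BachocVallentin`, points in
`EuclideanSpace ℝ (Fin n)`):
* `Q n k u v t := P^{(n-3)/2}_k(2(t - uv), (1-u²)(1-v²))` in the bivariate homogeneous
  normalisation of `Literature.Analysis.SpecialFunctions.gegenbauerHom`
  (`= ((1-u²)(1-v²))^{k/2} C_k^{(n-3)/2}(…)`, a positive multiple `C_k^{(n-3)/2}(1)` of BV's `Q_k^{n-1}`;
  positive scalings do not affect any positivity statement);
* `sum_sum_Q_nonneg` — **(pos Y) for all `n ≥ 4` and all `k`**: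
  `Σ_{i,j} c_i c_j Q n k (e·p_i) (e·p_j) (p_i·p_j) ≥ 0` for unit `e, p_i`. Proof: an orthonormal frame of
  the hyperplane `(ℝe)^⊥` (dimension `n - 1`, `Submodule.finrank_orthogonal_span_singleton`) carries the
  projections `x - (e·x)e` to coordinate vectors of `ℝ^{n-1}` with the right Gram data, and the
  tree's Schoenberg positivity `Literature.Analysis.SpecialFunctions.sum_mul_gegenbauerHom_nonneg`
  (zonal Gegenbauer kernels of `ℝ^{n-1}` are positive semidefinite; Fischer pairing) applies with
  `μ = (n-3)/2 > 0`;
* the pair and triple sums `pairSum`, `tripleSum` over a configuration, their invariance under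
  permuting the three inner products, the symmetrisation `sym6` (reused from `ThreePointBound`), and
  `tripleSum_weight_nonneg` / `tripleSum_sym6_weight_nonneg` — **(pos S)**: for any weight function
  `g`, `Σ_{x,y,z ∈ C} g(x·y) g(x·z) Q n k (x·y) (x·z) (y·z) ≥ 0`, and the same for the symmetrised
  term (a positive semidefinite `F_k` is a nonnegative combination `Σ_r d_r w_r w_rᵀ` of such rank-one
  terms, `g = φ_{w_r}`);
* `pairSum_gegenbauer_nonneg` — the two-point positivity `Σ_{x,y ∈ C} C_k^{(n-2)/2}(x·y) ≥ 0`
  in `pairSum` form (from `DelsarteLP.sum_sum_gegenbauerSum_nonneg`).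
The bound itself (BV Theorem 4.2 for general `n` and general angle) is in
`ThreePointBoundGeneral`. The case `n = 4` with explicit quaternion frames and kernel-evaluable
tables is `ThreePointKernelP` / `KissingCertComp` (earlier, independent files). Not here: `n = 3`
(the inner kernel would be the Chebyshev kernel of `S¹`, parameter `0`), the matrices `Y_k^n` as
`Matrix`-valued objects, and the representation-theoretic derivation (we only need positivity).

## References
* C. Bachoc, F. Vallentin, *New upper bounds for kissing numbers from semidefinite programming*,
  J. Amer. Math. Soc. 21 (2008) 909–924, §3: Theorem 3.2, Remark 3.4, Corollary 3.5.
  [`BachocVallentin2007`]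
* G. E. Andrews, R. Askey, R. Roy, *Special Functions*, CUP 1999, Thm. 9.6.3 (addition theorem).
  [`AndrewsAskeyRoy1999`]
-/

noncomputable section

open Finset
open scoped RealInnerProductSpace

namespace Literature.Geometry.DiscreteGeometry

namespace BachocVallentin

open Literature.Analysis.SpecialFunctions

variable {n : ℕ}

/-! ### Pair and triple sums over a configuration of `ℝⁿ` -/

/-- `Σ_{x,y ∈ C} A(x·y)`. [cite: BachocVallentin2007, §4] -/
def pairSum (C : Finset (EuclideanSpace ℝ (Fin n))) (A : ℝ → ℝ) : ℝ :=
  ∑ x ∈ C, ∑ y ∈ C, A (inner ℝ x y)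

/-- `Σ_{x,y,z ∈ C} G(x·y, x·z, y·z)`. [cite: BachocVallentin2007, §4] -/
def tripleSum (C : Finset (EuclideanSpace ℝ (Fin n))) (G : ℝ → ℝ → ℝ → ℝ) : ℝ :=
  ∑ x ∈ C, ∑ y ∈ C, ∑ z ∈ C, G (inner ℝ x y) (inner ℝ x z) (inner ℝ y z)

/-- Invariance of the triple sum under `(u,v,t) ↦ (v,u,t)` (reindex `y ↔ z`); used in the proof of
(pos S). [cite: BachocVallentin2007, Corollary 3.5 (proof: the symmetrisation S_k^n)] -/
theorem tripleSum_perm12 (C : Finset (EuclideanSpace ℝ (Fin n))) (G : ℝ → ℝ → ℝ → ℝ) :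
    tripleSum C (fun u v t => G v u t) = tripleSum C G := by
  unfold tripleSum
  refine Finset.sum_congr rfl fun x _ => ?_
  rw [Finset.sum_comm]
  refine Finset.sum_congr rfl fun y _ => Finset.sum_congr rfl fun z _ => ?_
  rw [real_inner_comm y z]

/-- Invariance of the triple sum under `(u,v,t) ↦ (u,t,v)` (reindex `x ↔ y`); used in the proof of
(pos S). [cite: BachocVallentin2007, Corollary 3.5 (proof: the symmetrisation S_k^n)] -/
theorem tripleSum_perm23 (C : Finset (EuclideanSpace ℝ (Fin n))) (G : ℝ → ℝ → ℝ → ℝ) :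
    tripleSum C (fun u v t => G u t v) = tripleSum C G := by
  unfold tripleSum
  rw [Finset.sum_comm]
  refine Finset.sum_congr rfl fun x _ => Finset.sum_congr rfl fun y _ =>
    Finset.sum_congr rfl fun z _ => ?_
  rw [real_inner_comm x y]

/-- Reindexing a triple sum: swap the first two bound variables. [folklore] -/
private theorem sum3_swap12 (C : Finset (EuclideanSpace ℝ (Fin n)))
    (g : EuclideanSpace ℝ (Fin n) → EuclideanSpace ℝ (Fin n) → EuclideanSpace ℝ (Fin n) → ℝ) :
    (∑ x ∈ C, ∑ y ∈ C, ∑ z ∈ C, g x y z) = ∑ x ∈ C, ∑ y ∈ C, ∑ z ∈ C, g y x z := by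
  rw [Finset.sum_comm]

/-- Reindexing a triple sum: swap the last two bound variables. [folklore] -/
private theorem sum3_swap23 (C : Finset (EuclideanSpace ℝ (Fin n)))
    (g : EuclideanSpace ℝ (Fin n) → EuclideanSpace ℝ (Fin n) → EuclideanSpace ℝ (Fin n) → ℝ) :
    (∑ x ∈ C, ∑ y ∈ C, ∑ z ∈ C, g x y z) = ∑ x ∈ C, ∑ y ∈ C, ∑ z ∈ C, g x z y := by
  refine Finset.sum_congr rfl fun x _ => ?_
  rw [Finset.sum_comm]

/-- Invariance of the triple sum under `(u,v,t) ↦ (t,v,u)` (reindex `x ↔ z`); used in the proof of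
(pos S). [cite: BachocVallentin2007, Corollary 3.5 (proof: the symmetrisation S_k^n)] -/
theorem tripleSum_perm13 (C : Finset (EuclideanSpace ℝ (Fin n))) (G : ℝ → ℝ → ℝ → ℝ) :
    tripleSum C (fun u v t => G t v u) = tripleSum C G := by
  unfold tripleSum
  -- rename (x,y,z) ↦ (z,y,x): swap12, swap23, swap12
  rw [sum3_swap12, sum3_swap23, sum3_swap12]
  refine Finset.sum_congr rfl fun x _ => Finset.sum_congr rfl fun y _ =>
    Finset.sum_congr rfl fun z _ => ?_
  rw [real_inner_comm x y, real_inner_comm x z, real_inner_comm y z]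

/-- Invariance of the triple sum under the cyclic permutations of `(u,v,t)`; used in the proof of
(pos S). [cite: BachocVallentin2007, Corollary 3.5 (proof: the symmetrisation S_k^n)] -/
theorem tripleSum_cyc (C : Finset (EuclideanSpace ℝ (Fin n))) (G : ℝ → ℝ → ℝ → ℝ) :
    tripleSum C (fun u v t => G v t u) = tripleSum C G ∧
      tripleSum C (fun u v t => G t u v) = tripleSum C G := by
  constructor
  · unfold tripleSum
    rw [sum3_swap23, sum3_swap12]
    refine Finset.sum_congr rfl fun x _ => Finset.sum_congr rfl fun y _ =>
      Finset.sum_congr rfl fun z _ => ?_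
    rw [real_inner_comm x y, real_inner_comm x z]
  · unfold tripleSum
    rw [sum3_swap12, sum3_swap23]
    refine Finset.sum_congr rfl fun x _ => Finset.sum_congr rfl fun y _ =>
      Finset.sum_congr rfl fun z _ => ?_
    rw [real_inner_comm x z, real_inner_comm y z]

/-- The triple sum of the symmetrisation is six times the triple sum:
`Σ_{C³} (Σ_σ σY)(c·c', c·c'', c'·c'') = 6 Σ_{C³} Y(…)` (the step from (pos Y) to (pos S)).
[cite: BachocVallentin2007, Corollary 3.5 (proof: (pos S) from (pos Y))] -/
theorem tripleSum_sym6 (C : Finset (EuclideanSpace ℝ (Fin n))) (G : ℝ → ℝ → ℝ → ℝ) :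
    tripleSum C (sym6 G) = 6 * tripleSum C G := by
  have h12 := tripleSum_perm12 C G
  have h23 := tripleSum_perm23 C G
  have h13 := tripleSum_perm13 C G
  obtain ⟨hc1, hc2⟩ := tripleSum_cyc C G
  have hsplit : tripleSum C (sym6 G) = tripleSum C G + tripleSum C (fun u v t => G v u t) +
      tripleSum C (fun u v t => G u t v) + tripleSum C (fun u v t => G t v u) +
      tripleSum C (fun u v t => G v t u) + tripleSum C (fun u v t => G t u v) := by
    simp only [tripleSum, sym6, Finset.sum_add_distrib]
  rw [hsplit, h12, h23, h13, hc1, hc2]; ring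

/-- The triple sum is additive in the summand (linearity of `F ↦ Σ_{C³} F`, used to pass from the
blocks `⟨F_k, S_k^n⟩` to their sum). [cite: BachocVallentin2007, Theorem 4.2 (the sum Σ_k ⟨F_k, S_k^n⟩)] -/
theorem tripleSum_add (C : Finset (EuclideanSpace ℝ (Fin n))) (G H : ℝ → ℝ → ℝ → ℝ) :
    tripleSum C (fun u v t => G u v t + H u v t) = tripleSum C G + tripleSum C H := by
  simp only [tripleSum, Finset.sum_add_distrib]

/-- The triple sum is homogeneous in the summand (linearity of `F ↦ Σ_{C³} F`).
[cite: BachocVallentin2007, Theorem 4.2 (the sum Σ_k ⟨F_k, S_k^n⟩)] -/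
theorem tripleSum_smul (C : Finset (EuclideanSpace ℝ (Fin n))) (a : ℝ) (G : ℝ → ℝ → ℝ → ℝ) :
    tripleSum C (fun u v t => a * G u v t) = a * tripleSum C G := by
  simp only [tripleSum, Finset.mul_sum]

/-- The triple sum of a finite sum of summands (linearity of `F ↦ Σ_{C³} F`).
[cite: BachocVallentin2007, Theorem 4.2 (the sum Σ_k ⟨F_k, S_k^n⟩)] -/
theorem tripleSum_finset_sum {ι : Type*} (C : Finset (EuclideanSpace ℝ (Fin n))) (s : Finset ι)
    (G : ι → ℝ → ℝ → ℝ → ℝ) :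
    tripleSum C (fun u v t => ∑ i ∈ s, G i u v t) = ∑ i ∈ s, tripleSum C (G i) := by
  classical
  induction s using Finset.induction_on with
  | empty => simp [tripleSum]
  | insert a s ha ih =>
    simp only [Finset.sum_insert ha]
    rw [← ih, ← tripleSum_add]

/-! ### The kernels `Q_k^{n-1}` and their positivity around a pole -/

/-- Bachoc–Vallentin's three-point kernel for `S^{n-1} ⊂ ℝⁿ` in the bivariate homogeneous
normalisation: `Q n k u v t = P^{(n-3)/2}_k(2(t - uv), (1-u²)(1-v²))
= ((1-u²)(1-v²))^{k/2} C_k^{(n-3)/2}((t - uv)/√((1-u²)(1-v²)))`, i.e. `C_k^{(n-3)/2}(1) · Q_k^{n-1}(u,v,t)`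
with `Q_k^{n-1}` as printed (there `P_k^{n-1}` is normalised by `P_k^{n-1}(1) = 1`).
[cite: BachocVallentin2007, Theorem 3.2] -/
def Q (n k : ℕ) (u v t : ℝ) : ℝ :=
  gegenbauerHom (((n : ℝ) - 3) / 2) k (2 * (t - u * v)) ((1 - u ^ 2) * (1 - v ^ 2))

/-- `Q n 0 = 1` (`P_0 = 1`, so `Y_0^n` has entries `P_i(u) P_j(v)` and `S_0^n(1,1,1)` is the all-ones
matrix in the normalisation `P_i(1) = 1`). [cite: BachocVallentin2007, Theorem 3.2 (k = 0)] -/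
theorem Q_zero (n : ℕ) (u v t : ℝ) : Q n 0 u v t = 1 := by
  simp [Q, gegenbauerHom_zero]

/-- **Coordinates on the hyperplane `e^⊥`.** For a unit vector `e ∈ ℝⁿ` (`n ≥ 1`) there is a
coordinate map `φ : ℝⁿ → ℝ^{n-1}` (an orthonormal frame of `(ℝe)^⊥` applied to the projection
`x - (e·x)e`) with `Σ_j φ(x)_j φ(y)_j = x·y - (e·x)(e·y)` — the decomposition `x = ue + √(1-u²) x'`,
`x' ∈ S(( ℝe)^⊥)`, of the proof of BV Theorem 3.2, in coordinates.
[cite: BachocVallentin2007, Theorem 3.2 (proof: x = ue + √(1-u²)x')] -/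
theorem exists_hyperplane_coords (hn : 1 ≤ n) (e : EuclideanSpace ℝ (Fin n)) (he : ‖e‖ = 1) :
    ∃ φ : EuclideanSpace ℝ (Fin n) → (Fin (n - 1) → ℝ),
      ∀ x y, ∑ j, φ x j * φ y j = inner ℝ x y - inner ℝ e x * inner ℝ e y := by
  classical
  have he0 : e ≠ 0 := by
    intro h; rw [h, norm_zero] at he; exact zero_ne_one he
  haveI : Fact (Module.finrank ℝ (EuclideanSpace ℝ (Fin n)) = (n - 1) + 1) :=
    ⟨by rw [finrank_euclideanSpace_fin]; omega⟩
  have hdim : Module.finrank ℝ (Submodule.span ℝ {e})ᗮ = n - 1 :=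
    Submodule.finrank_orthogonal_span_singleton he0
  let b : OrthonormalBasis (Fin (n - 1)) ℝ (Submodule.span ℝ {e})ᗮ :=
    (stdOrthonormalBasis ℝ _).reindex (finCongr hdim)
  have hee : inner ℝ e e = (1 : ℝ) := by rw [real_inner_self_eq_norm_sq, he]; norm_num
  have hw : ∀ x : EuclideanSpace ℝ (Fin n), x - inner ℝ e x • e ∈ (Submodule.span ℝ {e})ᗮ := by
    intro x
    rw [Submodule.mem_orthogonal_singleton_iff_inner_right]
    simp only [inner_sub_right, real_inner_smul_right, hee, mul_one, sub_self]
  refine ⟨fun x j => b.repr ⟨x - inner ℝ e x • e, hw x⟩ j, fun x y => ?_⟩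
  have h1 : ∀ X Y : EuclideanSpace ℝ (Fin (n - 1)), ∑ j, X j * Y j = inner ℝ X Y := by
    intro X Y
    rw [PiLp.inner_apply X Y]
    exact Finset.sum_congr rfl fun j _ => by simp [mul_comm]
  rw [h1, LinearIsometryEquiv.inner_map_map, Submodule.coe_inner]
  simp only [inner_sub_left, inner_sub_right, real_inner_smul_left, real_inner_smul_right, hee]
  rw [real_inner_comm e x]
  ring

/-- **(pos Y): positivity of the three-point kernel around a pole, all dimensions `n ≥ 4` and all
degrees `k`** (Bachoc–Vallentin 2008, Theorem 3.1(d) with Theorem 3.2 / Remark 3.4, Corollary 3.5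
(pos Y)): for a unit vector `e ∈ ℝⁿ`, unit vectors `p_i` and real weights `c_i`,
`Σ_{i,j} c_i c_j Q n k (e·p_i) (e·p_j) (p_i·p_j) ≥ 0`. [cite: BachocVallentin2007, Corollary 3.5] -/
theorem sum_sum_Q_nonneg (hn : 4 ≤ n) (k : ℕ) (e : EuclideanSpace ℝ (Fin n)) (he : ‖e‖ = 1)
    {ι : Type*} (s : Finset ι) (c : ι → ℝ) (p : ι → EuclideanSpace ℝ (Fin n))
    (hp : ∀ i ∈ s, ‖p i‖ = 1) :
    0 ≤ ∑ i ∈ s, ∑ j ∈ s,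
      c i * c j * Q n k (inner ℝ e (p i)) (inner ℝ e (p j)) (inner ℝ (p i) (p j)) := by
  classical
  obtain ⟨φ, hφ⟩ := exists_hyperplane_coords (by omega) e he
  have hφsq : ∀ x : EuclideanSpace ℝ (Fin n), ‖x‖ = 1 → ∑ j, φ x j ^ 2 = 1 - inner ℝ e x ^ 2 := by
    intro x hx
    have h := hφ x x
    simp only [← sq] at h
    rw [h, real_inner_self_eq_norm_sq, hx]; ring
  -- Schoenberg positivity in dimension `n - 1` with `μ = (n-3)/2 > 0`
  have hμ : (((n - 1 : ℕ)) : ℝ) = 2 * (((n : ℝ) - 3) / 2) + 2 := by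
    rw [Nat.cast_sub (by omega)]
    push_cast; ring
  have hμpos : 0 < ((n : ℝ) - 3) / 2 := by
    have : (4 : ℝ) ≤ n := by exact_mod_cast hn
    linarith
  have key := sum_mul_gegenbauerHom_nonneg hμ hμpos k (fun i : s => φ (p i)) (fun i => c i)
  have hterm : ∀ a b : s,
      c a * c b * gegenbauerHom (((n : ℝ) - 3) / 2) k (2 * ∑ l, φ (p a) l * φ (p b) l)
        ((∑ l, φ (p a) l ^ 2) * ∑ l, φ (p b) l ^ 2) =
      c a * c b * Q n k (inner ℝ e (p a)) (inner ℝ e (p b)) (inner ℝ (p a) (p b)) := by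
    intro a b
    rw [hφ, hφsq _ (hp a a.2), hφsq _ (hp b b.2), Q]
  simp only [hterm] at key
  have hsum : (∑ i ∈ s, ∑ j ∈ s,
      c i * c j * Q n k (inner ℝ e (p i)) (inner ℝ e (p j)) (inner ℝ (p i) (p j))) =
      ∑ a : s, ∑ b : s,
        c a * c b * Q n k (inner ℝ e (p a)) (inner ℝ e (p b)) (inner ℝ (p a) (p b)) := by
    rw [← Finset.sum_coe_sort s (fun i => ∑ j ∈ s,
      c i * c j * Q n k (inner ℝ e (p i)) (inner ℝ e (p j)) (inner ℝ (p i) (p j)))]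
    refine Finset.sum_congr rfl fun a _ => ?_
    rw [← Finset.sum_coe_sort s (fun j =>
      c a * c j * Q n k (inner ℝ e (p a)) (inner ℝ e (p j)) (inner ℝ (p a) (p j)))]
  rw [hsum]
  exact key

/-- **(pos S), rank-one form**: for a finite set `C` of unit vectors of `ℝⁿ` (`n ≥ 4`), any weight
function `g` (e.g. `g(u) = Σ_a w_a P_a^{n+2k}(u)` for a vector `w`) and every `k`,
`Σ_{x,y,z ∈ C} g(x·y) g(x·z) Q n k (x·y) (x·z) (y·z) ≥ 0` — sum over the pole `x ∈ C` of (pos Y).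
[cite: BachocVallentin2007, Corollary 3.5] -/
theorem tripleSum_weight_nonneg (hn : 4 ≤ n) (k : ℕ) (g : ℝ → ℝ)
    (C : Finset (EuclideanSpace ℝ (Fin n))) (hC : ∀ x ∈ C, ‖x‖ = 1) :
    0 ≤ tripleSum C (fun u v t => g u * g v * Q n k u v t) := by
  unfold tripleSum
  refine Finset.sum_nonneg fun x hx => ?_
  exact sum_sum_Q_nonneg hn k x (hC x hx) C (fun y => g (inner ℝ x y)) (fun y => y) hC

/-- **(pos S), symmetrised rank-one form**: the triple sum of
`sym6 (g(u) g(v) Q n k (u,v,t))` (`= 6 wᵀ S_k^n w`-type term) is `≥ 0`.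
[cite: BachocVallentin2007, Corollary 3.5] -/
theorem tripleSum_sym6_weight_nonneg (hn : 4 ≤ n) (k : ℕ) (g : ℝ → ℝ)
    (C : Finset (EuclideanSpace ℝ (Fin n))) (hC : ∀ x ∈ C, ‖x‖ = 1) :
    0 ≤ tripleSum C (sym6 fun u v t => g u * g v * Q n k u v t) := by
  rw [tripleSum_sym6]
  exact mul_nonneg (by norm_num) (tripleSum_weight_nonneg hn k g C hC)

/-! ### Two-point positivity in `pairSum` form -/

/-- **Two-point (Schoenberg) positivity** in `pairSum` form: for unit vectors of `ℝⁿ`, `n ≥ 3`,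
`Σ_{x,y ∈ C} C_k^{(n-2)/2}(x·y) ≥ 0` (`C_k^{μ} = gegenbauerSum μ k`).
[cite: BachocVallentin2007, §3 (pos 1)] -/
theorem pairSum_gegenbauer_nonneg (hn : 3 ≤ n) (k : ℕ) (C : Finset (EuclideanSpace ℝ (Fin n)))
    (hC : ∀ x ∈ C, ‖x‖ = 1) :
    0 ≤ pairSum C (fun t => gegenbauerSum (((n : ℝ) - 2) / 2) k t) := by
  classical
  have hμ : ((n : ℕ) : ℝ) = 2 * (((n : ℝ) - 2) / 2) + 2 := by ring
  have hμpos : 0 < ((n : ℝ) - 2) / 2 := by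
    have : (3 : ℝ) ≤ n := by exact_mod_cast hn
    linarith
  have key := DelsarteLP.sum_sum_gegenbauerSum_nonneg hμ hμpos k (ι := C)
    (fun a j => (a : EuclideanSpace ℝ (Fin n)) j) (fun a => by
      rw [← EuclideanSpace.real_norm_sq_eq, hC a a.2, one_pow])
  have hinner : ∀ a b : C, inner ℝ (a : EuclideanSpace ℝ (Fin n)) (b : EuclideanSpace ℝ (Fin n)) =
      ∑ j, (a : EuclideanSpace ℝ (Fin n)) j * (b : EuclideanSpace ℝ (Fin n)) j := by
    intro a b; simp [PiLp.inner_apply, mul_comm]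
  unfold pairSum
  rw [← Finset.sum_coe_sort C (fun x => ∑ y ∈ C, gegenbauerSum (((n : ℝ) - 2) / 2) k (inner ℝ x y))]
  have hsum : ∀ a : C, (∑ y ∈ C, gegenbauerSum (((n : ℝ) - 2) / 2) k
      (inner ℝ (a : EuclideanSpace ℝ (Fin n)) y)) =
      ∑ b : C, gegenbauerSum (((n : ℝ) - 2) / 2) k
        (∑ j, (a : EuclideanSpace ℝ (Fin n)) j * (b : EuclideanSpace ℝ (Fin n)) j) := by
    intro a
    rw [← Finset.sum_coe_sort C (fun y => gegenbauerSum (((n : ℝ) - 2) / 2) k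
      (inner ℝ (a : EuclideanSpace ℝ (Fin n)) y))]
    exact Finset.sum_congr rfl fun b _ => by rw [hinner]
  simp only [hsum]
  exact key

/-- Two-point positivity for a nonnegative Gegenbauer combination
`A(t) = Σ_{k ≤ d} a_k C_k^{(n-2)/2}(t)`, `a_k ≥ 0`: `pairSum C A ≥ 0`.
[cite: BachocVallentin2007, §3 (pos 1)] -/
theorem pairSum_gegenbauer_comb_nonneg (hn : 3 ≤ n) (d : ℕ) (a : ℕ → ℝ) (ha : ∀ k, 0 ≤ a k)
    (C : Finset (EuclideanSpace ℝ (Fin n))) (hC : ∀ x ∈ C, ‖x‖ = 1) :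
    0 ≤ pairSum C (fun t => ∑ k ∈ range (d + 1), a k * gegenbauerSum (((n : ℝ) - 2) / 2) k t) := by
  have hswap : pairSum C (fun t => ∑ k ∈ range (d + 1), a k * gegenbauerSum (((n : ℝ) - 2) / 2) k t)
      = ∑ k ∈ range (d + 1), a k * pairSum C (fun t => gegenbauerSum (((n : ℝ) - 2) / 2) k t) := by
    simp only [pairSum, Finset.mul_sum]
    have h1 : ∀ x ∈ C, (∑ y ∈ C, ∑ k ∈ range (d + 1),
        a k * gegenbauerSum (((n : ℝ) - 2) / 2) k (inner ℝ x y)) =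
        ∑ k ∈ range (d + 1), ∑ y ∈ C, a k * gegenbauerSum (((n : ℝ) - 2) / 2) k (inner ℝ x y) :=
      fun x _ => Finset.sum_comm
    rw [Finset.sum_congr rfl h1, Finset.sum_comm]
  rw [hswap]
  exact Finset.sum_nonneg fun k _ => mul_nonneg (ha k) (pairSum_gegenbauer_nonneg hn k C hC)

end BachocVallentin

end Literature.Geometry.DiscreteGeometry

end
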